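import Literature.NumberTheory.Transcendental.PadicExpBallProofs
import HarnessLib

/-!
# The `ℓ`-adic exponential on the CLOSED ball `‖a‖ ≤ ℓ⁻¹` for an odd prime `ℓ`

Everything in this file is **proved**; there are no definitions. Sequel to
`PadicExpBallProofs.lean`, which treats Mathlib's `NormedSpace.exp` on the OPEN ball `‖a‖ < ℓ⁻¹` of
a complete normed `ℚ_ℓ`-algebra field `E`. For `ℓ ≥ 3` the disc of convergence `‖a‖ < ℓ^{-1/(ℓ-1)}`
contains the closed ball `‖a‖ ≤ ℓ⁻¹`, and all the isometry properties persist there; this is the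
range needed by the `ℓ`-adic theory of linear forms in logarithms, where the logarithm `log_ℓ α`
of a principal unit `α ≡ 1 (mod ℓ)` has norm EXACTLY `ℓ⁻¹` in general (Yu, *Linear forms in
p-adic logarithms II*, §1.1: `exp` and `log` are inverse isometries between `ord_p z > 1/(p−1)` and
`ord_p (w − 1) > 1/(p−1)`; for `p ≥ 3` the point `ord_p z = 1` is inside).

* `two_mul_padicValNat_factorial_le` — Legendre for odd `ℓ`: `2 v_ℓ(n!) ≤ n − 1`;
* `inv_sqrt_le_expSeries_radius` — `ℓ^{-1/2} ≤` radius of the exponential series, hence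
  `mem_eball_of_norm_le`: the closed ball `‖a‖ ≤ ℓ⁻¹` lies in the disc of convergence;
* `exp_add_of_norm_le`, `hasSum_exp_of_norm_le`, `exp_natCast_mul_of_norm_le`,
  `exp_intCast_mul_of_norm_le`, `exp_neg_of_norm_le` — functional equation and the series;
* `norm_pow_div_factorial_lt_of_norm_le` — `‖aⁿ/n!‖ ≤ ‖a‖/√ℓ < ‖a‖` for `n ≥ 2`, `0 < ‖a‖ ≤ ℓ⁻¹`;
* `norm_exp_sub_one_of_norm_le`, `norm_exp_of_norm_le`, `exp_eq_one_iff_of_norm_le`,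
  `exp_injOn_closedBall` — `‖exp a − 1‖ = ‖a‖`, `‖exp a‖ = 1`, injectivity on the closed ball.

## References
* N. Koblitz, *p-adic Numbers, p-adic Analysis, and Zeta-Functions*, GTM 58 (1984), Ch. IV §1
  (radius `p^{-1/(p-1)}` of `exp_p`; isometry).
* Kunrui Yu, *Linear forms in p-adic logarithms II*, Compositio Math. 74 (1990), §1.1.
-/

noncomputable section

open NormedSpace Filter Topology Metric
open scoped ENNReal NNReal Nat

namespace Literature.NumberTheory.Transcendental

namespace PadicExp

variable {ℓ : ℕ} [Fact ℓ.Prime]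

/-! ### Legendre's bound for odd primes -/

/-- **Legendre for odd `ℓ`**: `2 · v_ℓ(n!) ≤ n − 1` (from `(ℓ − 1) v_ℓ(n!) < n` and `ℓ − 1 ≥ 2`).
[cite: Koblitz1984, Ch. IV §1] -/
theorem two_mul_padicValNat_factorial_le (hℓ : 3 ≤ ℓ) (n : ℕ) :
    2 * padicValNat ℓ n ! ≤ n - 1 := by
  rcases Nat.eq_zero_or_pos n with rfl | hn
  · simp
  · have h := sub_one_mul_padicValNat_factorial_lt_of_ne_zero ℓ hn.ne'
    have h2 : 2 * padicValNat ℓ n ! ≤ (ℓ - 1) * padicValNat ℓ n ! :=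
      Nat.mul_le_mul_right _ (by omega)
    omega

/-- `‖(n!)⁻¹‖_ℓ² ≤ ℓ^{n-1}` for odd `ℓ`. [cite: Koblitz1984, Ch. IV §1] -/
theorem norm_inv_natCast_factorial_padic_sq_le (hℓ : 3 ≤ ℓ) (n : ℕ) :
    ‖((n ! : ℕ) : ℚ_[ℓ])⁻¹‖ ^ 2 ≤ (ℓ : ℝ) ^ (n - 1) := by
  have hp : ℓ.Prime := Fact.out
  have hne : ((n ! : ℕ) : ℚ_[ℓ]) ≠ 0 := by exact_mod_cast n.factorial_ne_zero
  rw [norm_inv, Padic.norm_eq_zpow_neg_valuation hne, Padic.valuation_natCast, zpow_neg, inv_inv,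
    zpow_natCast, ← pow_mul]
  refine pow_le_pow_right₀ (by exact_mod_cast hp.one_lt.le) ?_
  have := two_mul_padicValNat_factorial_le hℓ n
  rw [mul_comm]; exact this

variable {E : Type*} [NontriviallyNormedField E] [NormedAlgebra ℚ_[ℓ] E]

/-- `‖(n!)⁻¹‖_E² ≤ ℓ^{n-1}` for odd `ℓ`. [cite: Koblitz1984, Ch. IV §1] -/
theorem norm_inv_natCast_factorial_sq_le (hℓ : 3 ≤ ℓ) (n : ℕ) :
    ‖((n ! : ℕ) : E)⁻¹‖ ^ 2 ≤ (ℓ : ℝ) ^ (n - 1) := by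
  rw [norm_inv, norm_natCast (ℓ := ℓ), ← norm_inv]
  exact norm_inv_natCast_factorial_padic_sq_le hℓ n

/-! ### The radius of convergence exceeds `ℓ⁻¹` -/

/-- **`ℓ^{-1/2} ≤` radius of convergence** of the exponential series over `ℚ_ℓ`, `ℓ` odd:
`(‖expSeries n‖ ℓ^{-n/2})² ≤ ℓ^{n-1} ℓ^{-n} ≤ 1`. [cite: Koblitz1984, Ch. IV §1] -/
theorem inv_sqrt_le_expSeries_radius (hℓ : 3 ≤ ℓ) :
    (((NNReal.sqrt ℓ)⁻¹ : ℝ≥0) : ℝ≥0∞) ≤ (expSeries ℚ_[ℓ] E).radius := by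
  have hp : ℓ.Prime := Fact.out
  have hℓ0 : (0 : ℝ) < ℓ := by exact_mod_cast hp.pos
  refine FormalMultilinearSeries.le_radius_of_bound _ 1 fun n => ?_
  have h1 : ‖expSeries ℚ_[ℓ] E n‖ ^ 2 ≤ (ℓ : ℝ) ^ (n - 1) := by
    rw [expSeries, norm_smul, ContinuousMultilinearMap.norm_mkPiAlgebraFin, mul_one]
    have : ((n !⁻¹ : ℚ_[ℓ])) = ((n ! : ℕ) : ℚ_[ℓ])⁻¹ := by norm_cast
    rw [this]
    exact norm_inv_natCast_factorial_padic_sq_le hℓ n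
  have hr : (((NNReal.sqrt ℓ)⁻¹ : ℝ≥0) : ℝ) ^ 2 = (ℓ : ℝ)⁻¹ := by
    rw [NNReal.coe_inv, inv_pow, ← NNReal.coe_pow, NNReal.sq_sqrt, NNReal.coe_natCast]
  have hr0 : 0 ≤ (((NNReal.sqrt ℓ)⁻¹ : ℝ≥0) : ℝ) := NNReal.coe_nonneg _
  set r : ℝ := (((NNReal.sqrt ℓ)⁻¹ : ℝ≥0) : ℝ) with hrdef
  have hsq : (‖expSeries ℚ_[ℓ] E n‖ * r ^ n) ^ 2 ≤ 1 := by
    rw [mul_pow, ← pow_mul, mul_comm n 2, pow_mul, hr, inv_pow]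
    calc ‖expSeries ℚ_[ℓ] E n‖ ^ 2 * ((ℓ : ℝ) ^ n)⁻¹ ≤ (ℓ : ℝ) ^ (n - 1) * ((ℓ : ℝ) ^ n)⁻¹ :=
          mul_le_mul_of_nonneg_right h1 (by positivity)
      _ ≤ (ℓ : ℝ) ^ n * ((ℓ : ℝ) ^ n)⁻¹ := by
          gcongr
          · exact_mod_cast hp.one_lt.le
          · exact Nat.sub_le n 1
      _ = 1 := mul_inv_cancel₀ (by positivity)
  have hx0 : 0 ≤ ‖expSeries ℚ_[ℓ] E n‖ * r ^ n := by positivity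
  nlinarith

/-- Points of the closed ball `‖a‖ ≤ ℓ⁻¹` lie in the disc of convergence (`ℓ` odd).
[cite: Koblitz1984, Ch. IV §1] -/
theorem mem_eball_of_norm_le (hℓ : 3 ≤ ℓ) {a : E} (ha : ‖a‖ ≤ (ℓ : ℝ)⁻¹) :
    a ∈ eball (0 : E) (expSeries ℚ_[ℓ] E).radius := by
  rw [mem_eball_zero_iff]
  refine lt_of_lt_of_le ?_ (inv_sqrt_le_expSeries_radius hℓ)
  have hp : ℓ.Prime := Fact.out
  have hℓ1 : (1 : ℝ) < ℓ := by exact_mod_cast hp.one_lt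
  have hℓ0 : (0 : ℝ) < ℓ := by linarith
  -- `ℓ⁻¹ < (√ℓ)⁻¹`
  have hlt : (ℓ : ℝ)⁻¹ < (Real.sqrt ℓ)⁻¹ := by
    rw [inv_lt_inv₀ hℓ0 (Real.sqrt_pos.mpr hℓ0)]
    calc Real.sqrt ℓ = Real.sqrt ℓ * 1 := (mul_one _).symm
      _ < Real.sqrt ℓ * Real.sqrt ℓ :=
          mul_lt_mul_of_pos_left (by rw [Real.lt_sqrt zero_le_one]; simpa using hℓ1)
            (Real.sqrt_pos.mpr hℓ0)
      _ = ℓ := Real.mul_self_sqrt hℓ0.le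
  rw [enorm_eq_nnnorm, ENNReal.coe_lt_coe, ← NNReal.coe_lt_coe, coe_nnnorm, NNReal.coe_inv,
    Real.coe_sqrt, NNReal.coe_natCast]
  exact lt_of_le_of_lt ha hlt


/-! ### The functional equation and the series on the closed ball -/

section Complete

variable [CompleteSpace E]

/-- **`exp (a + b) = exp a · exp b`** on the closed ball `‖·‖ ≤ ℓ⁻¹` (`ℓ` odd).
[cite: Koblitz1984, Ch. IV §1] -/
theorem exp_add_of_norm_le (hℓ : 3 ≤ ℓ) {a b : E} (ha : ‖a‖ ≤ (ℓ : ℝ)⁻¹) (hb : ‖b‖ ≤ (ℓ : ℝ)⁻¹) :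
    exp (a + b) = exp a * exp b :=
  exp_add_of_mem_ball (mem_eball_of_norm_le hℓ ha) (mem_eball_of_norm_le hℓ hb)

/-- The exponential series `exp a = ∑ aⁿ / n!` on the closed ball (`ℓ` odd).
[cite: Koblitz1984, Ch. IV §1] -/
theorem hasSum_exp_of_norm_le (hℓ : 3 ≤ ℓ) {a : E} (ha : ‖a‖ ≤ (ℓ : ℝ)⁻¹) :
    HasSum (fun n : ℕ => a ^ n / (n ! : E)) (exp a) := by
  have h := expSeries_hasSum_exp_of_mem_ball' (𝕂 := ℚ_[ℓ]) a (mem_eball_of_norm_le hℓ ha)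
  refine h.congr_fun fun n => ?_
  rw [inv_natCast_smul_eq ℚ_[ℓ] E, smul_eq_mul, div_eq_mul_inv, mul_comm]

/-- `exp a = ∑' aⁿ / n!` on the closed ball (`ℓ` odd). [cite: Koblitz1984, Ch. IV §1] -/
theorem exp_eq_tsum_of_norm_le (hℓ : 3 ≤ ℓ) {a : E} (ha : ‖a‖ ≤ (ℓ : ℝ)⁻¹) :
    exp a = ∑' n : ℕ, a ^ n / (n ! : E) :=
  (hasSum_exp_of_norm_le hℓ ha).tsum_eq.symm

/-- `exp (n a) = (exp a)ⁿ` for `n ∈ ℕ` on the closed ball (`ℓ` odd). [cite: Koblitz1984, Ch. IV §1] -/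
theorem exp_natCast_mul_of_norm_le (hℓ : 3 ≤ ℓ) {a : E} (ha : ‖a‖ ≤ (ℓ : ℝ)⁻¹) (n : ℕ) :
    exp ((n : E) * a) = exp a ^ n := by
  induction n with
  | zero => simp
  | succ n ih =>
    have hn : ‖(n : E) * a‖ ≤ (ℓ : ℝ)⁻¹ := by
      rw [norm_mul]
      exact (mul_le_of_le_one_left (norm_nonneg _) (norm_natCast_le_one (ℓ := ℓ) n)).trans ha
    rw [Nat.cast_succ, add_mul, one_mul, exp_add_of_norm_le hℓ hn ha, ih, pow_succ]

/-- `exp (-a) = (exp a)⁻¹` on the closed ball (`ℓ` odd). [cite: Koblitz1984, Ch. IV §1] -/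
theorem exp_neg_of_norm_le (hℓ : 3 ≤ ℓ) {a : E} (ha : ‖a‖ ≤ (ℓ : ℝ)⁻¹) : exp (-a) = (exp a)⁻¹ := by
  have hna : ‖-a‖ ≤ (ℓ : ℝ)⁻¹ := by rwa [norm_neg]
  have h : exp a * exp (-a) = 1 := by rw [← exp_add_of_norm_le hℓ ha hna, add_neg_cancel, exp_zero]
  exact eq_inv_of_mul_eq_one_right h

/-- `exp (z a) = (exp a)^z` for `z ∈ ℤ` on the closed ball (`ℓ` odd). [cite: Koblitz1984, Ch. IV §1] -/
theorem exp_intCast_mul_of_norm_le (hℓ : 3 ≤ ℓ) {a : E} (ha : ‖a‖ ≤ (ℓ : ℝ)⁻¹) (z : ℤ) :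
    exp ((z : E) * a) = exp a ^ z := by
  obtain ⟨n, rfl | rfl⟩ := z.eq_nat_or_neg
  · rw [Int.cast_natCast, exp_natCast_mul_of_norm_le hℓ ha, zpow_natCast]
  · have hn : ‖(n : E) * a‖ ≤ (ℓ : ℝ)⁻¹ := by
      rw [norm_mul]
      exact (mul_le_of_le_one_left (norm_nonneg _) (norm_natCast_le_one (ℓ := ℓ) n)).trans ha
    rw [Int.cast_neg, Int.cast_natCast, neg_mul, exp_neg_of_norm_le hℓ hn,
      exp_natCast_mul_of_norm_le hℓ ha, zpow_neg, zpow_natCast]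

end Complete

/-! ### Ultrametric estimates on the closed ball -/

section Ultra

variable [IsUltrametricDist E] [CompleteSpace E]

omit [IsUltrametricDist E] [CompleteSpace E] in
/-- The higher terms are uniformly smaller than `a` on the closed ball (`ℓ` odd):
`‖aⁿ/n!‖² ≤ ‖a‖^{2n} ℓ^{n-1} ≤ ‖a‖² · (‖a‖² ℓ)` for `n ≥ 2`, `‖a‖ ≤ ℓ⁻¹` (and `‖a‖² ℓ ≤ ℓ⁻¹ < 1`).
[cite: Koblitz1984, Ch. IV §1] -/
theorem norm_pow_div_factorial_sq_le_of_norm_le (hℓ : 3 ≤ ℓ) {a : E} (ha : ‖a‖ ≤ (ℓ : ℝ)⁻¹)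
    {n : ℕ} (hn : 2 ≤ n) : ‖a ^ n / (n ! : E)‖ ^ 2 ≤ ‖a‖ ^ 2 * (‖a‖ ^ 2 * ℓ) := by
  have hp : ℓ.Prime := Fact.out
  have hℓ1 : (1 : ℝ) < ℓ := by exact_mod_cast hp.one_lt
  have hℓ0 : (0 : ℝ) < ℓ := by linarith
  have hfac : ((n ! : E)) = ((n ! : ℕ) : E) := by norm_cast
  rw [div_eq_mul_inv, norm_mul, norm_pow, mul_pow, hfac, ← pow_mul]
  have h1 : ‖((n ! : ℕ) : E)⁻¹‖ ^ 2 ≤ (ℓ : ℝ) ^ (n - 1) := norm_inv_natCast_factorial_sq_le hℓ n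
  have hq : ‖a‖ ^ 2 * ℓ ≤ (ℓ : ℝ)⁻¹ := by
    have : ‖a‖ ^ 2 ≤ (ℓ : ℝ)⁻¹ ^ 2 := pow_le_pow_left₀ (norm_nonneg _) ha 2
    calc ‖a‖ ^ 2 * ℓ ≤ (ℓ : ℝ)⁻¹ ^ 2 * ℓ := mul_le_mul_of_nonneg_right this hℓ0.le
      _ = (ℓ : ℝ)⁻¹ := by field_simp
  have hq1 : ‖a‖ ^ 2 * ℓ ≤ 1 := hq.trans (inv_le_one_of_one_le₀ hℓ1.le)
  have hq0 : 0 ≤ ‖a‖ ^ 2 * ℓ := by positivity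
  calc ‖a‖ ^ (n * 2) * ‖((n ! : ℕ) : E)⁻¹‖ ^ 2
      ≤ ‖a‖ ^ (n * 2) * (ℓ : ℝ) ^ (n - 1) := mul_le_mul_of_nonneg_left h1 (by positivity)
    _ = ‖a‖ ^ 2 * (‖a‖ ^ 2 * ℓ) ^ (n - 1) := by
        obtain ⟨k, rfl⟩ := Nat.exists_eq_add_of_le hn
        rw [show 2 + k - 1 = k + 1 by omega, mul_pow, ← pow_mul]
        ring_nf
    _ ≤ ‖a‖ ^ 2 * (‖a‖ ^ 2 * ℓ) ^ 1 := by
        refine mul_le_mul_of_nonneg_left ?_ (by positivity)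
        exact pow_le_pow_of_le_one hq0 hq1 (by omega)
    _ = ‖a‖ ^ 2 * (‖a‖ ^ 2 * ℓ) := by rw [pow_one]

/-- **`‖exp a - 1 - a‖ < ‖a‖`** for `0 < ‖a‖ ≤ ℓ⁻¹` (`ℓ` odd). [cite: Koblitz1984, Ch. IV §1] -/
theorem norm_exp_sub_one_sub_self_lt_of_norm_le (hℓ : 3 ≤ ℓ) {a : E} (ha : ‖a‖ ≤ (ℓ : ℝ)⁻¹)
    (ha0 : a ≠ 0) : ‖exp a - 1 - a‖ < ‖a‖ := by
  have hp : ℓ.Prime := Fact.out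
  have hℓ1 : (1 : ℝ) < ℓ := by exact_mod_cast hp.one_lt
  have hℓ0 : (0 : ℝ) < ℓ := by linarith
  have hs := hasSum_exp_of_norm_le hℓ ha
  have hs2 : HasSum (fun n : ℕ => a ^ (n + 2) / ((n + 2) ! : E)) (exp a - 1 - a) := by
    have h := (hasSum_nat_add_iff' 2).mpr hs
    simp only [Finset.sum_range_succ, Finset.sum_range_zero, zero_add, pow_zero,
      Nat.factorial_zero, Nat.cast_one, div_one, pow_one, Nat.factorial_one] at h
    rw [show exp a - 1 - a = exp a - (1 + a) by ring]
    exact h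
  rw [← hs2.tsum_eq]
  have hapos : 0 < ‖a‖ := norm_pos_iff.mpr ha0
  -- uniform bound `M = √(‖a‖² (‖a‖² ℓ)) < ‖a‖`
  set M : ℝ := Real.sqrt (‖a‖ ^ 2 * (‖a‖ ^ 2 * ℓ)) with hM
  have hM0 : 0 ≤ M := Real.sqrt_nonneg _
  have hterm : ∀ n : ℕ, ‖a ^ (n + 2) / ((n + 2)! : E)‖ ≤ M := by
    intro n
    rw [hM]
    refine (Real.le_sqrt (norm_nonneg _) (by positivity)).mpr ?_
    exact norm_pow_div_factorial_sq_le_of_norm_le hℓ ha (by omega)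
  have hMlt : M < ‖a‖ := by
    rw [hM, Real.sqrt_lt' hapos]
    have hq : ‖a‖ ^ 2 * ℓ < 1 := by
      have : ‖a‖ ^ 2 ≤ (ℓ : ℝ)⁻¹ ^ 2 := pow_le_pow_left₀ (norm_nonneg _) ha 2
      calc ‖a‖ ^ 2 * ℓ ≤ (ℓ : ℝ)⁻¹ ^ 2 * ℓ := mul_le_mul_of_nonneg_right this hℓ0.le
        _ = (ℓ : ℝ)⁻¹ := by field_simp
        _ < 1 := inv_lt_one_of_one_lt₀ hℓ1
    calc ‖a‖ ^ 2 * (‖a‖ ^ 2 * ℓ) < ‖a‖ ^ 2 * 1 := mul_lt_mul_of_pos_left hq (by positivity)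
      _ = ‖a‖ ^ 2 := mul_one _
  exact (IsUltrametricDist.norm_tsum_le_of_forall_le_of_nonneg hM0 hterm).trans_lt hMlt

/-- **`‖exp a - 1‖ = ‖a‖`** on the closed ball `‖a‖ ≤ ℓ⁻¹` (`ℓ` odd): `exp` is an isometry there.
[cite: Koblitz1984, Ch. IV §1] -/
theorem norm_exp_sub_one_of_norm_le (hℓ : 3 ≤ ℓ) {a : E} (ha : ‖a‖ ≤ (ℓ : ℝ)⁻¹) :
    ‖exp a - 1‖ = ‖a‖ := by
  by_cases ha0 : a = 0
  · subst ha0; simp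
  have h := norm_exp_sub_one_sub_self_lt_of_norm_le hℓ ha ha0
  have : exp a - 1 = (exp a - 1 - a) + a := by ring
  rw [this]
  exact IsUltrametricDist.norm_add_eq_max_of_norm_ne_norm h.ne ▸ max_eq_right h.le

/-- **`‖exp a‖ = 1`** on the closed ball (`ℓ` odd). [cite: Koblitz1984, Ch. IV §1] -/
theorem norm_exp_of_norm_le (hℓ : 3 ≤ ℓ) {a : E} (ha : ‖a‖ ≤ (ℓ : ℝ)⁻¹) : ‖exp a‖ = 1 := by
  have hp : ℓ.Prime := Fact.out
  have h1 : ‖exp a - 1‖ < 1 := by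
    rw [norm_exp_sub_one_of_norm_le hℓ ha]
    exact ha.trans_lt (inv_lt_one_of_one_lt₀ (by exact_mod_cast hp.one_lt))
  have : exp a = (exp a - 1) + 1 := by ring
  rw [this]
  have hne : ‖exp a - 1‖ ≠ ‖(1 : E)‖ := by rw [norm_one]; exact h1.ne
  rw [IsUltrametricDist.norm_add_eq_max_of_norm_ne_norm hne, norm_one, max_eq_right h1.le]

/-- `exp a ≠ 0` on the closed ball (`ℓ` odd). [cite: Koblitz1984, Ch. IV §1] -/
theorem exp_ne_zero_of_norm_le (hℓ : 3 ≤ ℓ) {a : E} (ha : ‖a‖ ≤ (ℓ : ℝ)⁻¹) : exp a ≠ 0 := by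
  intro h
  have := norm_exp_of_norm_le hℓ ha
  rw [h, norm_zero] at this
  exact zero_ne_one this

/-- `exp a = 1 ↔ a = 0` on the closed ball (`ℓ` odd). [cite: Koblitz1984, Ch. IV §1] -/
theorem exp_eq_one_iff_of_norm_le (hℓ : 3 ≤ ℓ) {a : E} (ha : ‖a‖ ≤ (ℓ : ℝ)⁻¹) :
    exp a = 1 ↔ a = 0 := by
  refine ⟨fun h => ?_, fun h => by rw [h, exp_zero]⟩
  have := norm_exp_sub_one_of_norm_le hℓ ha
  rw [h, sub_self, norm_zero] at this
  exact norm_eq_zero.mp this.symm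

/-- **`exp` is an isometry of the closed ball** `‖·‖ ≤ ℓ⁻¹` (`ℓ` odd):
`‖exp a - exp b‖ = ‖a - b‖`. [cite: Koblitz1984, Ch. IV §1] -/
theorem norm_exp_sub_exp_of_norm_le (hℓ : 3 ≤ ℓ) {a b : E} (ha : ‖a‖ ≤ (ℓ : ℝ)⁻¹)
    (hb : ‖b‖ ≤ (ℓ : ℝ)⁻¹) : ‖exp a - exp b‖ = ‖a - b‖ := by
  have hnb : ‖-b‖ ≤ (ℓ : ℝ)⁻¹ := by rwa [norm_neg]
  have hab : ‖a - b‖ ≤ (ℓ : ℝ)⁻¹ := by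
    rw [sub_eq_add_neg]
    exact (IsUltrametricDist.norm_add_le_max a (-b)).trans (max_le ha hnb)
  have h1 : exp a - exp b = exp b * (exp (a - b) - 1) := by
    rw [mul_sub, mul_one, ← exp_add_of_norm_le hℓ hb hab, add_sub_cancel]
  rw [h1, norm_mul, norm_exp_of_norm_le hℓ hb, one_mul, norm_exp_sub_one_of_norm_le hℓ hab]

/-- **`exp` is injective on the closed ball** `‖·‖ ≤ ℓ⁻¹` (`ℓ` odd). [cite: Koblitz1984, Ch. IV §1] -/
theorem exp_injOn_closedBall (hℓ : 3 ≤ ℓ) :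
    Set.InjOn (exp : E → E) {a : E | ‖a‖ ≤ (ℓ : ℝ)⁻¹} := by
  intro a ha b hb hab
  have h := norm_exp_sub_exp_of_norm_le hℓ (a := a) (b := b) ha hb
  rw [hab, sub_self, norm_zero] at h
  exact sub_eq_zero.mp (norm_eq_zero.mp h.symm)

end Ultra

end PadicExp

end Literature.NumberTheory.Transcendental

end
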